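import Literature.AlgebraicGeometry.Motives.HodgeLieWeightOnePlusLine
import Mathlib.RingTheory.Flat.Basic
import Mathlib.LinearAlgebra.TensorProduct.Pi
import HarnessLib

/-!
# A centre-free Hodge Lie algebra has a centre-free complexification: `𝔷(𝔥) = 0 ⟹ 𝔷(𝔥_ℂ) = 0`, and `E F = αP`,
# `F E = α(1 − P)` in the position `dim 𝔥⁺ = 1` with `𝔷 = 0`

Family `hodge`, layer `Literature/AlgebraicGeometry/Motives`; THEOREMS ONLY (no definition, no named fact; D-0026).
Groundwork for the `ℚ`-SIMPLE branch of the rung `dim MT(H¹X) = 7` of the cell `pub-hodgecm2` (COR-CM) lane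
MT-RANK-SEVEN-SPLIT, seat `b27`: the bridge from the RATIONAL hypothesis `𝔷 = Lie Hg ∩ End_Hdg(V) = 0` to the COMPLEX
hypothesis «every element of `𝔥_ℂ` commuting with `𝔥_ℂ` vanishes» used by
`HodgeStructure.projE_mul_projF_eq_smul_of_plusLine` (`Motives/HodgeLieWeightOnePlusLine` §4).

* §1 `eq_zero_of_mem_spanC_of_forall_commute` — PURE LINEAR ALGEBRA: for a `ℚ`-subspace `𝔤 ⊆ End_ℚ V` whose only element
  commuting with `𝔤` is `0`, the only element of the complex span `𝔤_ℂ = span_ℂ {X_ℂ : X ∈ 𝔤}` commuting with all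
  `X_ℂ`, `X ∈ 𝔤`, is `0`.  PROOF: for a basis `Y₁, …, Y_m` of `𝔤` the map `F : 𝔤 → (End_ℚ V)^m`,
  `W ↦ (W Yⱼ − Yⱼ W)ⱼ`, is injective, hence so is `ℂ ⊗ F` (`ℂ` is flat over `ℚ`,
  `Module.Flat.lTensor_preserves_injective_linearMap`); under the comparison `ℂ ⊗ End_ℚ V ≃ End_ℂ V_ℂ`
  (`endBaseChangeEquiv`) and `ℂ ⊗ (End_ℚ V)^m ≃ (ℂ ⊗ End_ℚ V)^m` (`TensorProduct.piRight`) the `j`-th component of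
  `(ℂ ⊗ F)(s)` is `[Φ s, (Yⱼ)_ℂ]` for `Φ : ℂ ⊗ 𝔤 ↠ 𝔤_ℂ`, `c ⊗ W ↦ c W_ℂ` — Deligne's «structure rationnelle» argument
  (I §3, proof of 3.4) made explicit.
* §2 `eq_zero_of_mem_hodgeLieC_of_forall_commute` — for a `ℚ`-Hodge structure `H` with
  `Lie Hg(H) ∩ End_Hdg(V) = 0` (the centre of `Lie Hg`, `hodgeLie_center_eq_inf_endAlg`), every element of `𝔥_ℂ`
  commuting with `𝔥_ℂ` is `0`.
* §3 `projE_mul_projF_eq_smul_of_plusLine_of_center_eq_bot` — §4 of `HodgeLieWeightOnePlusLine` with the rational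
  hypothesis: weight one, `𝔷 = 0`, `dim 𝔥⁺ = 1` ⟹ `E F = αP`, `F E = α(1 − P)`, `E F + F E = α`, `α ≠ 0` — the type-III
  position `V_ℂ = E V_ℂ ⊕ F V_ℂ ≅ std ⊗ W` (Moonen–Zarhin (2.3)), with no bound on `dim 𝔥`.

## References

* [Deligne1982HodgeCycles] P. Deligne, *Hodge cycles on abelian varieties*, LNM 900 (1982), I §3 (proof of Prop. 3.4:
  rational structures and extension of scalars; Prop. 3.6).
* [MoonenZarhin1999LowDim] B. Moonen, Yu. Zarhin, *Hodge classes on abelian varieties of low dimension*, Math. Ann. 315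
  (1999), §1 (centre of `Hg`), §2, (2.3) Type III.
-/

noncomputable section

open scoped TensorProduct

namespace Literature.AlgebraicGeometry.Motives

universe u

namespace HodgeStructure

open ProjectorBlocks Literature.RepresentationTheory.GeneralLinear

variable {V : Type u} [AddCommGroup V] [Module ℚ V] [Module.Finite ℚ V] [HodgeTensorFacts.{u, u}] {n : ℤ}
  {S : Type u} [Fintype S] [DecidableEq S] {deg : S → ℤ}

/-! ## §1 The complex span of a centre-free rational space of endomorphisms is centre-free -/

omit [HodgeTensorFacts.{u, u}] in
/-- **Rational structures and the centre.**  Let `𝔤 ⊆ End_ℚ V` be a `ℚ`-subspace whose only element commuting with all of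
`𝔤` is `0`.  Then the only element of `𝔤_ℂ = span_ℂ {X_ℂ : X ∈ 𝔤}` commuting with every `X_ℂ`, `X ∈ 𝔤`, is `0`:
`W ↦ ([W, Yⱼ])ⱼ` (`Yⱼ` a basis of `𝔤`) is injective on `𝔤`, so its base change to the flat `ℚ`-module `ℂ` is injective on
`ℂ ⊗ 𝔤 ↠ 𝔤_ℂ`. [cite: Deligne1982HodgeCycles, I §3 (proof of Prop. 3.4)] -/
theorem eq_zero_of_mem_spanC_of_forall_commute (𝔤 : Submodule ℚ (Module.End ℚ V))
    (hz : ∀ W ∈ 𝔤, (∀ Y ∈ 𝔤, W * Y = Y * W) → W = 0) {W : Module.End ℂ (ℂ ⊗[ℚ] V)} (hW : W ∈ spanC 𝔤)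
    (hWc : ∀ Y ∈ 𝔤, W * Y.baseChange ℂ = Y.baseChange ℂ * W) : W = 0 := by
  classical
  obtain ⟨b⟩ : Nonempty (Module.Basis (Fin (Module.finrank ℚ 𝔤)) ℚ 𝔤) := ⟨Module.finBasis ℚ 𝔤⟩
  -- `G j : 𝔤 → End_ℚ V`, `w ↦ w Yⱼ − Yⱼ w`; `F = (G j)ⱼ`
  obtain ⟨G, hGdef⟩ : ∃ G : Fin (Module.finrank ℚ 𝔤) → (𝔤 →ₗ[ℚ] Module.End ℚ V),
      G = fun j => (LinearMap.mulRight ℚ ((b j : 𝔤) : Module.End ℚ V) -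
        LinearMap.mulLeft ℚ ((b j : 𝔤) : Module.End ℚ V)) ∘ₗ 𝔤.subtype := ⟨_, rfl⟩
  have hG : ∀ j (w : 𝔤), G j w = (w : Module.End ℚ V) * (b j : Module.End ℚ V) - (b j : Module.End ℚ V) * w := by
    intro j w
    rw [hGdef]
    rfl
  obtain ⟨F, hFdef⟩ : ∃ F : 𝔤 →ₗ[ℚ] (Fin (Module.finrank ℚ 𝔤) → Module.End ℚ V), F = LinearMap.pi G := ⟨_, rfl⟩
  have hFapply : ∀ (w : 𝔤) j, F w j = G j w := fun w j => by rw [hFdef, LinearMap.pi_apply]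
  -- `F` is injective: its kernel is the centre of `𝔤`
  have hFinj : Function.Injective F := by
    rw [← LinearMap.ker_eq_bot, LinearMap.ker_eq_bot']
    intro w hw
    have hj : ∀ j, (w : Module.End ℚ V) * (b j : Module.End ℚ V) = (b j : Module.End ℚ V) * w := fun j => by
      have h := congr_fun hw j
      rw [hFapply, hG, Pi.zero_apply, sub_eq_zero] at h
      exact h
    have hall : ∀ Y ∈ 𝔤, (w : Module.End ℚ V) * Y = Y * w := by
      intro Y hY
      have hYsum : Y = ∑ j, b.repr ⟨Y, hY⟩ j • ((b j : 𝔤) : Module.End ℚ V) := by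
        have h := congrArg (𝔤.subtype : 𝔤 → Module.End ℚ V) (b.sum_repr ⟨Y, hY⟩)
        rw [map_sum] at h
        simp only [map_smul, Submodule.subtype_apply] at h
        exact h.symm
      rw [hYsum, Finset.mul_sum, Finset.sum_mul]
      refine Finset.sum_congr rfl fun j _ => ?_
      rw [mul_smul_comm, smul_mul_assoc, hj]
    exact (Submodule.coe_eq_zero).1 (hz w w.2 hall)
  -- `ℂ` is flat over `ℚ`
  have hFC : Function.Injective (F.lTensor ℂ) := Module.Flat.lTensor_preserves_injective_linearMap F hFinj
  -- `Φ : ℂ ⊗ 𝔤 → End_ℂ V_ℂ`, `c ⊗ w ↦ c • w_ℂ`, maps onto `𝔤_ℂ`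
  obtain ⟨Φ, hΦdef⟩ : ∃ Φ : ℂ ⊗[ℚ] 𝔤 →ₗ[ℂ] Module.End ℂ (ℂ ⊗[ℚ] V),
      Φ = (endBaseChangeEquiv V).toLinearMap ∘ₗ 𝔤.subtype.baseChange ℂ := ⟨_, rfl⟩
  have hΦ : ∀ (c : ℂ) (w : 𝔤), Φ (c ⊗ₜ[ℚ] w) = c • (w : Module.End ℚ V).baseChange ℂ := fun c w => by
    rw [hΦdef, LinearMap.comp_apply, LinearMap.baseChange_tmul, LinearEquiv.coe_toLinearMap, endBaseChangeEquiv_tmul,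
      Submodule.subtype_apply]
  have hrange : spanC 𝔤 ≤ LinearMap.range Φ := by
    refine Submodule.span_le.2 ?_
    rintro _ ⟨Y, hY, rfl⟩
    exact ⟨(1 : ℂ) ⊗ₜ[ℚ] (⟨Y, hY⟩ : 𝔤), by rw [hΦ, one_smul]⟩
  obtain ⟨s, rfl⟩ := hrange hW
  -- the `j`-th component of `(ℂ ⊗ F) s` is `[Φ s, (Yⱼ)_ℂ]`
  have hcompat : ∀ j (t : ℂ ⊗[ℚ] 𝔤), endBaseChangeEquiv V ((G j).lTensor ℂ t) =
      Φ t * ((b j : 𝔤) : Module.End ℚ V).baseChange ℂ - ((b j : 𝔤) : Module.End ℚ V).baseChange ℂ * Φ t := by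
    intro j t
    induction t using TensorProduct.induction_on with
    | zero => rw [map_zero, map_zero, map_zero, zero_mul, mul_zero, sub_zero]
    | tmul c w =>
      rw [LinearMap.lTensor_tmul, hΦ, endBaseChangeEquiv_tmul, hG, LinearMap.baseChange_sub,
        LinearMap.baseChange_mul, LinearMap.baseChange_mul, smul_sub, smul_mul_assoc, mul_smul_comm]
    | add x y hx hy =>
      simp only [map_add]
      rw [hx, hy, add_mul, mul_add]
      abel
  have hG0 : ∀ j, (G j).lTensor ℂ s = 0 := fun j => by
    apply (endBaseChangeEquiv V).injective
    rw [hcompat, map_zero, hWc _ (b j).2, sub_self]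
  -- hence `(ℂ ⊗ F) s = 0` (`ℂ ⊗ (End_ℚ V)^m ≃ (ℂ ⊗ End_ℚ V)^m`) and `s = 0`
  have hpi : ∀ (t : ℂ ⊗[ℚ] 𝔤) j,
      TensorProduct.piRight ℚ ℂ ℂ (fun _ : Fin (Module.finrank ℚ 𝔤) => Module.End ℚ V) (F.lTensor ℂ t) j =
        (G j).lTensor ℂ t := by
    intro t j
    induction t using TensorProduct.induction_on with
    | zero => rw [map_zero, map_zero, Pi.zero_apply, map_zero]
    | tmul c w =>
      rw [LinearMap.lTensor_tmul, LinearMap.lTensor_tmul, TensorProduct.piRight_apply, TensorProduct.piRightHom_tmul]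
      show c ⊗ₜ[ℚ] F w j = _
      rw [hFapply]
    | add x y hx hy => rw [map_add, map_add, Pi.add_apply, hx, hy, map_add]
  have hFs : F.lTensor ℂ s = 0 := by
    apply (TensorProduct.piRight ℚ ℂ ℂ (fun _ : Fin (Module.finrank ℚ 𝔤) => Module.End ℚ V)).injective
    rw [map_zero]
    funext j
    rw [hpi, hG0, Pi.zero_apply]
  have hs : s = 0 := hFC (by rw [hFs, map_zero])
  rw [hs, map_zero]

/-! ## §2 `𝔷(Lie Hg) = 0 ⟹` the complexification `𝔥_ℂ` is centre-free -/

/-- **If `Lie Hg(H) ∩ End_Hdg(V) = 0` then every element of `𝔥_ℂ` commuting with `𝔥_ℂ` vanishes** (`H` a `ℚ`-Hodge structure of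
any weight on a finite-dimensional `V`): `Lie Hg ∩ End_Hdg(V)` is the centre of `Lie Hg` (`hodgeLie_center_eq_inf_endAlg`,
Moonen–Zarhin §1), and §1 transports «centre-free» to the complex span `𝔥_ℂ`.
[cite: MoonenZarhin1999LowDim, §1] [cite: Deligne1982HodgeCycles, I §3 (proof of Prop. 3.4)] -/
theorem eq_zero_of_mem_hodgeLieC_of_forall_commute (H : HodgeStructure V n)
    (hcenter : H.hodgeLie ⊓ Subalgebra.toSubmodule H.endAlg = ⊥) {W : Module.End ℂ (ℂ ⊗[ℚ] V)}
    (hW : W ∈ H.hodgeLieC) (hWc : ∀ Y ∈ H.hodgeLieC, W * Y = Y * W) : W = 0 := by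
  have hz : ∀ Z ∈ H.hodgeLie, (∀ Y ∈ H.hodgeLie, Z * Y = Y * Z) → Z = 0 := by
    intro Z hZ hZc
    have hmem : Z ∈ H.hodgeLie ⊓
        Subalgebra.toSubmodule (Subalgebra.centralizer ℚ (H.hodgeLie : Set (Module.End ℚ V))) :=
      (Literature.Algebra.Lie.TraceSeparating.mem_center_iff H.hodgeLie Z).2 ⟨hZ, hZc⟩
    rw [hodgeLie_center_eq_inf_endAlg, hcenter] at hmem
    exact (Submodule.mem_bot ℚ).1 hmem
  rw [hodgeLieC_eq_spanC] at hW
  exact eq_zero_of_mem_spanC_of_forall_commute H.hodgeLie hz hW fun Y hY => hWc _ (H.baseChange_mem_hodgeLieC hY)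

/-! ## §3 Weight one, `𝔷 = 0`, `dim 𝔥⁺ = 1`: `E F = αP`, `F E = α(1 − P)` -/

/-- **`E F = αP`, `F E = α(1 − P)`, `E F + F E = α ≠ 0` for a weight-one polarizable `H` with `Lie Hg ∩ End_Hdg(V) = 0` whose
Hodge Lie algebra has a one-dimensional positive part** (`𝔥⁺ = ℂE`, `𝔥⁻ = ℂF` for the blocks `E = P X_ℂ (1 − P)`,
`F = (1 − P) X_ℂ P` of some rational `X ∈ 𝔥 ∖ End_Hdg`): §4 of `HodgeLieWeightOnePlusLine` with its complex-centre hypothesis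
discharged by §2.  This is the type-III position `V_ℂ = E V_ℂ ⊕ F V_ℂ ≅ std ⊗ W` of Moonen–Zarhin (2.3), reached here with no
bound on `dim 𝔥`. [cite: MoonenZarhin1999LowDim, §2 and (2.3)] [cite: Deligne1982HodgeCycles, I §3 (proof of Prop. 3.4)] -/
theorem projE_mul_projF_eq_smul_of_plusLine_of_center_eq_bot (H : HodgeStructure V n) (ψ : H.Polarization)
    (hn : n = 1) (e : Module.Basis S ℂ (ℂ ⊗[ℚ] V)) (hF : ∀ a, H.F a = Submodule.span ℂ (e '' {σ | a ≤ deg σ}))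
    (hFc : ∀ a, complexConj (H.F a) = Submodule.span ℂ (e '' {σ | deg σ ≤ n - a}))
    (hdeg : ∀ σ, deg σ = 0 ∨ deg σ = 1) {X : Module.End ℚ V} (hX : X ∈ H.hodgeLie) (hXE : X ∉ H.endAlg)
    (hplus : ∀ Y ∈ H.hodgeLieC, ∃ c : ℂ,
      gradingEnd e deg * Y * (1 - gradingEnd e deg) = c • (gradingEnd e deg * X.baseChange ℂ * (1 - gradingEnd e deg)))
    (hminus : ∀ Y ∈ H.hodgeLieC, ∃ c : ℂ,
      (1 - gradingEnd e deg) * Y * gradingEnd e deg = c • ((1 - gradingEnd e deg) * X.baseChange ℂ * gradingEnd e deg))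
    (hcenter : H.hodgeLie ⊓ Subalgebra.toSubmodule H.endAlg = ⊥) :
    ∃ α : ℂ, α ≠ 0 ∧
      (gradingEnd e deg * X.baseChange ℂ * (1 - gradingEnd e deg)) *
          ((1 - gradingEnd e deg) * X.baseChange ℂ * gradingEnd e deg) = α • gradingEnd e deg ∧
      ((1 - gradingEnd e deg) * X.baseChange ℂ * gradingEnd e deg) *
          (gradingEnd e deg * X.baseChange ℂ * (1 - gradingEnd e deg)) = α • (1 - gradingEnd e deg) ∧
      (gradingEnd e deg * X.baseChange ℂ * (1 - gradingEnd e deg)) *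
            ((1 - gradingEnd e deg) * X.baseChange ℂ * gradingEnd e deg) +
          ((1 - gradingEnd e deg) * X.baseChange ℂ * gradingEnd e deg) *
            (gradingEnd e deg * X.baseChange ℂ * (1 - gradingEnd e deg)) = α • 1 :=
  projE_mul_projF_eq_smul_of_plusLine H ψ hn e hF hFc hdeg hX hXE hplus hminus
    fun _ hW hWc => eq_zero_of_mem_hodgeLieC_of_forall_commute H hcenter hW hWc

end HodgeStructure

end Literature.AlgebraicGeometry.Motives

end
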